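import Literature.AlgebraicGeometry.HodgeTheory.GeneralHodgePropertyOfSmallChowGroupsAllBidegrees
import Literature.AlgebraicGeometry.HodgeTheory.MaxRationalSubHodgeStructureKunnethAlgebraicCohomology
import Literature.AlgebraicGeometry.HodgeTheory.MaxRationalSubHodgeStructureKunnethAlgebraicPieces
import Literature.AlgebraicGeometry.HodgeTheory.GeneralHodgePropertyOfVanishingHodgeNumbers
import Literature.AlgebraicGeometry.HodgeTheory.HypersurfaceLefschetzReduction
import Literature.AlgebraicGeometry.HodgeTheory.BettiHodgeNumbersOfHodgeModels
import Literature.AlgebraicGeometry.HodgeTheory.SupportedClassesSemipurity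
import Literature.AlgebraicGeometry.HodgeTheory.HardLefschetzNFoldHolds
import HarnessLib

/-!
# Voisin II Thm. 10.31 on the tree's carriers, every level `k₀`: `CH₀, …, CH_{k₀}` of rank `≤ 1` ⟹ `h^{p,q}(X) = 0` for `p ≠ q`, `min(p,q) ≤ k₀`; `H^{2p+1}(X) = 0` for `p ≤ k₀` and `H^{2p}(X)`
# ALGEBRAIC for `p ≤ k₀ + 1` (and the hard-Lefschetz mirrors); so `dim X ≤ 2k₀ + 2` ⟹ ALL the cohomology of `X` is algebraic, `HC(Z × X) ⟺ HC(Z)` and `GHC(Z × X) ⟸ GHC(Z)` for every `Z`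
# (Voisin II Thm. 10.29, Thm. 10.31; Laterveer 1998; Bloch–Srinivas 1983; Voisin 2025 Cor. 5.7; Grothendieck 1969; Voisin I Thm. 6.25, §11.3.3)

Family `hodge`, lane `lit-hodgefound` (Track 2 foundations library; Layers A1/A4), layer `Literature/AlgebraicGeometry/HodgeTheory`.  THEOREMS ONLY (no definition, no named fact, no instance;
D-0026 net debt `0`).  Sequel of the seat's g33-#7/#9 (`hodgeConjectureFor_of_chowRankLEOneUpTo`; `supportedClasses_eq_top_of_chowRankLEOneUpTo_of_le`, `forall_generalHodgePropertyFor_of_chowRankLEOneUpTo`)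
and of the tree's `GeneralHodgePropertyOfSmallChowGroup` (`k₀ = 0`: `BettiUniverse.hodgeNumber_eq_zero_of_chowRankLEOneUpTo_zero`, `h^{k,0} = h^{0,k} = 0`), `MaxRationalSubHodgeStructureKunnethAlgebraicCohomology`
/ `…AlgebraicPieces` (`HC(Z × X) ⟺ HC(Z)`, `GHC(Z × X) ⟸ GHC(Z)` when ALL the cohomology of `X` is algebraic: hypotheses `hodd`, `halg`) and `HypersurfaceLefschetzReduction` (`HardLefschetzNFold.algebraicClasses_eq_top_of_lt`).

THE ARGUMENT (Voisin II §10.3.1, proof of Thm. 10.31, in every degree).  `Motives.ChowRankLEOneUpTo X k₀` gives `Nʳ Hᵏ(X) = Hᵏ(X)` for `r ≤ k₀ + 1`, `2r ≤ k + 1` (generalised decomposition of the diagonal,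
PROVED in the tree; g33-#9 §1).  (a) HODGE NUMBERS: `Nʳ Hᵏ ⊆ Fʳ Hᵏ`, so `h^{p,q} = 0` for `p < r`; with `r = p + 1 ≤ k₀ + 1` and `2p + 1 ≤ p + q` this is `h^{p,q}(X) = 0` for `p ≤ k₀`, `p < q` — and `h^{q,p} = 0` by Hodge
symmetry (Thm. 10.31 as printed: «`H^{p,q}(X) = 0` for `p ≠ q` and `p ≤ k₀` (or `q ≤ k₀`)»).  (b) ODD DEGREES: `N^{p+1} H^{2p+1} = H^{2p+1}` (`p ≤ k₀`) and `N^{p+1} H^{2p+1} = 0` (semipurity, `2p + 1 < 2(p + 1)`) give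
`H^{2p+1}(X) = 0`; by hard Lefschetz also `H^{2n−2p−1}(X) = 0`.  (c) EVEN DEGREES: `Nᵖ H^{2p} = H^{2p}` for `p ≤ k₀ + 1` says every class of degree `2p` is algebraic (`algebraicClasses X p` IS `Nᵖ H^{2p}` in the tree); by
hard Lefschetz (`Lʲ` preserves algebraicity and is onto above the middle) also in degree `2n − 2p`.  (d) Hence for `dim X ≤ 2k₀ + 2` every odd Betti group vanishes and every even one is algebraic, which
are exactly the hypotheses `hodd`, `halg` of the tree's Künneth theorems for a factor with algebraic cohomology.

WHAT IS PROVED (`0` sorrys; every statement a theorem).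
* §1 **`BettiUniverse.hodgeNumber_eq_zero_of_chowRankLEOneUpTo`** (Thm. 10.31: `h^{p,q} = h^{q,p} = 0` for `p ≤ k₀`, `p < q`), `BettiUniverse.hodgeNumber_eq_zero_of_chowRankLEOneUpTo_of_ne` (`p ≠ q`, `min ≤ k₀`).
* §2 `subsingleton_complexBetti_of_chowRankLEOneUpTo` (`H^{2p+1} = 0`, `p ≤ k₀`), `subsingleton_complexBetti_of_chowRankLEOneUpTo_of_hardLefschetz` (`H^{2n−2p−1} = 0`), `algebraicClasses_eq_top_of_chowRankLEOneUpTo`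
  (`p ≤ k₀ + 1`), `algebraicClasses_eq_top_of_chowRankLEOneUpTo_of_hardLefschetz` (`n ≤ p + k₀ + 1`, `p ≤ n`).
* §3 `dim X ≤ 2k₀ + 2`: `subsingleton_complexBetti_of_chowRankLEOneUpTo_of_odd`, `forall_algebraicClasses_eq_top_of_chowRankLEOneUpTo` (ALL cohomology algebraic), and for every smooth projective `Z`:
  **`hodgeConjectureFor_tensor_iff_of_chowRankLEOneUpTo`** (`HC(Z × X) ⟺ HC(Z)`), `hodgeConjectureFor_tensor_of_chowRankLEOneUpTo_of_hodgeConjectureFor` (+ mirror `X × Z`),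
  `forall_generalHodgePropertyFor_tensor_of_chowRankLEOneUpTo` (`GHC(Z)` everywhere ⟹ `GHC(Z × X)` everywhere), `forall_generalHodgePropertyFor_tensor_of_chowRankLEOneUpTo_both`.
* §4 Instances: surfaces with `CH₀ ⊗ ℚ` of rank `≤ 1` (`p_g = q = 0` in support form), fourfolds with `CH₀, CH₁` of rank `≤ 1`, sixfolds with `CH₀, CH₁, CH₂` of rank `≤ 1`: `HC(Z × X) ⟺ HC(Z)`.

THE PRINTS.  C. Voisin (2003) [VoisinHodgeII2003] §10.3.1 Thm. 10.29, Thm. 10.31 (statement and proof), §10.2.2 Thm. 10.17, Cor. 10.18; R. Laterveer (1998) [Laterveer1998] main theorem; S. Bloch, V. Srinivas (1983)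
[BlochSrinivas1983] Thm. 1; C. Voisin (2025) [Voisin2025] §5.2 Cor. 5.7, Introduction; A. Grothendieck (1969) [GrothendieckTopology1969] §1, pp. 300–301; C. Voisin (2002) [VoisinHodgeI2002] §6.2.3 Thm. 6.25, §7.1.2,
§11.3.3 Thm. 11.38–11.40; J. Carlson, S. Müller-Stach, C. Peters (2017) [CarlsonMullerStachPeters2017] §3.4 Examples 3.4.5 (i); D. Arapura (2006) [Arapura2006] §4 Lemma 4.2.

THE OBJECTS (all the tree's).  `Motives.ChowRankLEOneUpTo`, `supportedClasses`, `algebraicClasses` (`= supportedClasses X (2p) p`), `complexBetti`, `BettiUniverse.hodge`, `HodgeStructure.hodgeNumber`, `HardLefschetzNFold`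
(`nonempty_hardLefschetzNFold_holds`, `L`, `bijective_L`, `algebraicClasses_eq_top_of_lt`), `HodgeConjectureFor`, `GeneralHodgePropertyFor`; the tree's `supportedClasses_eq_bot_of_lt`, `subsingleton_complexBetti`,
`hodgeNumber_eq_zero_of_supportedClasses_eq_top`, `BettiUniverse.hodgeNumber_hodge_symm`, `hodgeConjectureFor_tensor_iff_of_forall_algebraic`, `hodgeConjectureFor_tensor_of_forall_algebraic`,
`forall_generalHodgePropertyFor_tensor_of_forall_algebraic`, `generalHodgePropertyFor_tensor_of_forall_algebraic_both`, `hodgeConjectureFor_tensor_comm_mp`, and the seat's `supportedClasses_eq_top_of_chowRankLEOneUpTo_of_le`,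
`forall_generalHodgePropertyFor_of_chowRankLEOneUpTo`.

DEVIATIONS / SCOPE.  Complex orientations (through the tree's supported-classes lemmas).  Thm. 10.31 is printed for `CH_i(X)_ℚ` «supported on subvarieties» / hom-trivial; the tree's predicate is
`ChowRankLEOneUpTo` (rank `≤ 1`), which is what the tree's decomposition theorem consumes.  «`Hᵏ = 0`» is rendered `Subsingleton (complexBetti X k)` (complex Betti cohomology of `X(ℂ)`).

## References
* [VoisinHodgeII2003] C. Voisin, *Hodge Theory and Complex Algebraic Geometry II* — §10.3.1 Thm. 10.29, Thm. 10.31; §10.2.2 Thm. 10.17, Cor. 10.18.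
* [Laterveer1998] R. Laterveer, *Algebraic varieties with small Chow groups*, J. Math. Kyoto Univ. 38 (1998) — main theorem.
* [BlochSrinivas1983] S. Bloch, V. Srinivas, Amer. J. Math. 105 (1983) — Thm. 1.
* [Voisin2025] C. Voisin (2025) — §5.2 Cor. 5.7; Introduction.
* [GrothendieckTopology1969] A. Grothendieck, Topology 8 (1969) — §1, pp. 300–301.
* [VoisinHodgeI2002] C. Voisin, *Hodge Theory and Complex Algebraic Geometry I* — §6.2.3 Thm. 6.25; §7.1.2; §11.3.3 Thm. 11.38–11.40.
* [CarlsonMullerStachPeters2017] J. Carlson, S. Müller-Stach, C. Peters, *Period Mappings and Period Domains* (2nd ed.) — §3.4 Examples 3.4.5 (i).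
* [Arapura2006] D. Arapura, Canad. J. Math. 58 (2006) — §4 Lemma 4.2.

## Provenance
Lane `lit-hodgefound` (summit `HodgeConjecture`, Track 2 foundations), seat `lit-hodgefound-p29` (literature-prover, generation 33, row g33-#10).
-/

noncomputable section

open CategoryTheory AlgebraicGeometry MonoidalCategory Module Finset
open Literature.AlgebraicTopology.SingularHomology
open Literature.Geometry.Kaehler

namespace Literature.AlgebraicGeometry.HodgeTheory

open Literature.AlgebraicGeometry.Motives

variable {n m : ℕ} {X Z : SchemeOver ℂ}

/-! ### §1 Voisin II Thm. 10.31: the Hodge numbers -/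

/-- **Voisin II, Thm. 10.31, on the tree's Betti carriers, every level: if `CH₀(X)_ℚ, …, CH_{k₀}(X)_ℚ` have rank `≤ 1` then `h^{p,q}(X) = 0` and `h^{q,p}(X) = 0` whenever `p ≤ k₀` and `p < q`**
(`N^{p+1} H^{p+q}(X) = H^{p+q}(X)` lies in `F^{p+1}`; Hodge symmetry).  `k₀ = 0`: the tree's `BettiUniverse.hodgeNumber_eq_zero_of_chowRankLEOneUpTo_zero` (`h^{0,k} = h^{k,0} = 0`, Bloch–Srinivas).
[cite: VoisinHodgeII2003, Thm. 10.31 (statement and proof) and Thm. 10.29] [cite: Laterveer1998, main theorem (as quoted in Vial2013 Thm. 7.1)] [cite: Voisin2025, Introduction and §5.2 Cor. 5.7] -/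
theorem BettiUniverse.hodgeNumber_eq_zero_of_chowRankLEOneUpTo (hHD : exists_isReal_hodgeModel) (hX : IsSmoothProjective n X) {k₀ : ℕ} (hCH : ChowRankLEOneUpTo X k₀) {k p q : ℕ}
    (hpq : p + q = k) (hp : p ≤ k₀) (hlt : p < q) :
    (BettiUniverse.hodge hHD hX k).hodgeNumber p q = 0 ∧ (BettiUniverse.hodge hHD hX k).hodgeNumber q p = 0 := by
  have h0 : (BettiUniverse.hodge hHD hX k).hodgeNumber p q = 0 :=
    hodgeNumber_eq_zero_of_supportedClasses_eq_top hHD hX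
      (supportedClasses_eq_top_of_chowRankLEOneUpTo_of_le hX hCH (r := p + 1) (by omega) (by omega)) hpq (Nat.lt_succ_self p)
  refine ⟨h0, ?_⟩
  rw [BettiUniverse.hodgeNumber_hodge_symm]
  exact h0

/-- The same, symmetric spelling: **`h^{p,q}(X) = 0` for `p ≠ q` with `min(p, q) ≤ k₀`.** [cite: VoisinHodgeII2003, Thm. 10.31] [cite: Laterveer1998, main theorem (as quoted in Vial2013 Thm. 7.1)] -/
theorem BettiUniverse.hodgeNumber_eq_zero_of_chowRankLEOneUpTo_of_ne (hHD : exists_isReal_hodgeModel) (hX : IsSmoothProjective n X) {k₀ : ℕ} (hCH : ChowRankLEOneUpTo X k₀) {k p q : ℕ}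
    (hpq : p + q = k) (hmin : min p q ≤ k₀) (hne : p ≠ q) : (BettiUniverse.hodge hHD hX k).hodgeNumber p q = 0 := by
  rcases Nat.lt_or_gt_of_ne hne with h | h
  · exact (BettiUniverse.hodgeNumber_eq_zero_of_chowRankLEOneUpTo hHD hX hCH hpq (by omega) h).1
  · exact (BettiUniverse.hodgeNumber_eq_zero_of_chowRankLEOneUpTo hHD hX hCH (show q + p = k by omega) (by omega) h).2

/-! ### §2 Odd degrees vanish, even degrees are algebraic -/

/-- **`H^{2p+1}(X(ℂ); ℂ) = 0` for `p ≤ k₀` when `CH₀, …, CH_{k₀}` have rank `≤ 1`** (`N^{p+1} H^{2p+1}` is everything, and is zero by semipurity). [cite: VoisinHodgeII2003, Thm. 10.31 (proof) and Thm. 10.29]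
[cite: Laterveer1998, main theorem (as quoted in Vial2013 Thm. 7.1)] -/
theorem subsingleton_complexBetti_of_chowRankLEOneUpTo (hX : IsSmoothProjective n X) {k₀ : ℕ} (hCH : ChowRankLEOneUpTo X k₀) {p : ℕ} (hp : p ≤ k₀) :
    Subsingleton (complexBetti X (2 * p + 1)) := by
  refine subsingleton_of_forall_eq 0 fun x ↦ ?_
  have hx : x ∈ supportedClasses X (2 * p + 1) (p + 1) := by
    rw [supportedClasses_eq_top_of_chowRankLEOneUpTo_of_le hX hCH (r := p + 1) (by omega) (by omega)]
    exact Submodule.mem_top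
  rwa [supportedClasses_eq_bot_of_lt hX (by omega), Submodule.mem_bot] at hx

/-- **Every class of `H^{2p}(X(ℂ); ℂ)` is algebraic for `p ≤ k₀ + 1` when `CH₀, …, CH_{k₀}` have rank `≤ 1`** (`Nᵖ H^{2p} = H^{2p}`; `algebraicClasses X p` is `Nᵖ H^{2p}`). [cite: VoisinHodgeII2003, Thm. 10.31 (proof) and Thm. 10.29]
[cite: Laterveer1998, main theorem (as quoted in Vial2013 Thm. 7.1)] [cite: GrothendieckTopology1969, §1] -/
theorem algebraicClasses_eq_top_of_chowRankLEOneUpTo (hX : IsSmoothProjective n X) {k₀ : ℕ} (hCH : ChowRankLEOneUpTo X k₀) {p : ℕ} (hp : p ≤ k₀ + 1) : algebraicClasses X p = ⊤ :=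
  supportedClasses_eq_top_of_chowRankLEOneUpTo_of_le hX hCH hp (by omega)

/-- **Hard-Lefschetz mirror, odd degrees: `Hᵏ(X(ℂ); ℂ) = 0` for odd `k ≥ n` with `2n ≤ k + 2k₀ + 1`** (`L^{k−n} : H^{2n−k} ⥲ Hᵏ` and `H^{2n−k} = 0` by §2; `k > 2n` is empty anyway).
[cite: VoisinHodgeI2002, §6.2.3 Thm. 6.25] [cite: VoisinHodgeII2003, Thm. 10.31 (proof)] -/
theorem subsingleton_complexBetti_of_chowRankLEOneUpTo_of_hardLefschetz (hX : IsSmoothProjective n X) {k₀ : ℕ} (hCH : ChowRankLEOneUpTo X k₀) {k : ℕ} (hk : Odd k) (hnk : n ≤ k)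
    (h : 2 * n ≤ k + 2 * k₀ + 1) : Subsingleton (complexBetti X k) := by
  by_cases h2 : 2 * n < k
  · exact subsingleton_complexBetti hX h2
  · obtain ⟨p, hp⟩ : ∃ p, 2 * n - k = 2 * p + 1 := ⟨(2 * n - k) / 2, by obtain ⟨a, rfl⟩ := hk; omega⟩
    haveI := subsingleton_complexBetti_of_chowRankLEOneUpTo hX hCH (p := p) (by omega)
    obtain ⟨Λ⟩ := nonempty_hardLefschetzNFold_holds n X hX
    exact (Λ.bijective_L (j := k - n) (k := 2 * p + 1) (by omega) k (by omega)).2.subsingleton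

/-- **Hard-Lefschetz mirror, even degrees: every class of `H^{2p}(X(ℂ); ℂ)` is algebraic for `p ≤ n ≤ p + k₀ + 1`** (`L^{2p−n} : H^{2n−2p} ⥲ H^{2p}` preserves algebraicity, and `H^{2n−2p}` is algebraic by §2).
[cite: VoisinHodgeI2002, §6.2.3 Thm. 6.25 and §7.1.2] [cite: VoisinHodgeII2003, §9.2.4 Prop. 9.20 and Thm. 10.31 (proof)] -/
theorem algebraicClasses_eq_top_of_chowRankLEOneUpTo_of_hardLefschetz (hX : IsSmoothProjective n X) {k₀ : ℕ} (hCH : ChowRankLEOneUpTo X k₀) {p : ℕ} (hpn : p ≤ n) (h : n ≤ p + k₀ + 1) :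
    algebraicClasses X p = ⊤ := by
  by_cases h2 : 2 * p ≤ n
  · exact algebraicClasses_eq_top_of_chowRankLEOneUpTo hX hCH (by omega)
  · obtain ⟨Λ⟩ := nonempty_hardLefschetzNFold_holds n X hX
    exact Λ.algebraicClasses_eq_top_of_lt (by omega) hpn (algebraicClasses_eq_top_of_chowRankLEOneUpTo hX hCH (by omega))

/-! ### §3 `dim X ≤ 2k₀ + 2`: all the cohomology of `X` is algebraic; products with `X` -/

/-- **For `dim X ≤ 2k₀ + 2` and `CH₀, …, CH_{k₀}` of rank `≤ 1`, every ODD Betti group of `X(ℂ)` vanishes.** [cite: VoisinHodgeII2003, Thm. 10.31 (proof)] [cite: VoisinHodgeI2002, §6.2.3 Thm. 6.25] -/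
theorem subsingleton_complexBetti_of_chowRankLEOneUpTo_of_odd (hX : IsSmoothProjective n X) {k₀ : ℕ} (hCH : ChowRankLEOneUpTo X k₀) (hn : n ≤ 2 * k₀ + 2) {k : ℕ} (hk : Odd k) :
    Subsingleton (complexBetti X k) := by
  obtain ⟨p, rfl⟩ : ∃ p, k = 2 * p + 1 := hk
  rcases Nat.lt_or_ge (2 * p + 1) n with hkn | hkn
  · exact subsingleton_complexBetti_of_chowRankLEOneUpTo hX hCH (by omega)
  · exact subsingleton_complexBetti_of_chowRankLEOneUpTo_of_hardLefschetz hX hCH ⟨p, rfl⟩ hkn (by omega)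

/-- **For `dim X ≤ 2k₀ + 2` and `CH₀, …, CH_{k₀}` of rank `≤ 1`, ALL the cohomology of `X(ℂ)` is algebraic**: `Nᵖ H^{2p} = H^{2p}` for every `p` (degrees `> 2n` are zero). [cite: VoisinHodgeII2003, Thm. 10.31 (proof)]
[cite: VoisinHodgeI2002, §6.2.3 Thm. 6.25] [cite: GrothendieckTopology1969, §1] -/
theorem forall_algebraicClasses_eq_top_of_chowRankLEOneUpTo (hX : IsSmoothProjective n X) {k₀ : ℕ} (hCH : ChowRankLEOneUpTo X k₀) (hn : n ≤ 2 * k₀ + 2) (p : ℕ) : algebraicClasses X p = ⊤ := by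
  rcases Nat.lt_or_ge n p with hnp | hpn
  · haveI := subsingleton_complexBetti hX (k := 2 * p) (by omega)
    exact eq_top_iff.2 fun x _ ↦ by rw [Subsingleton.elim x 0]; exact Submodule.zero_mem _
  by_cases hp : p ≤ k₀ + 1
  · exact algebraicClasses_eq_top_of_chowRankLEOneUpTo hX hCH hp
  · exact algebraicClasses_eq_top_of_chowRankLEOneUpTo_of_hardLefschetz hX hCH hpn (by omega)

/-- **`HC(Z × X) ⟺ HC(Z)` for every smooth projective `Z`, when `CH₀(X), …, CH_{k₀}(X)` have rank `≤ 1` and `dim X ≤ 2k₀ + 2`** (all the cohomology of `X` is algebraic; the tree's Künneth theorem for such a factor).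
[cite: GrothendieckTopology1969, pp. 300–301] [cite: VoisinHodgeI2002, §11.3.3 Thm. 11.38, Thm. 11.40 and p. 287] [cite: CarlsonMullerStachPeters2017, §3.4 Examples 3.4.5 (i)] [cite: Arapura2006, §4 Lemma 4.2]
[cite: VoisinHodgeII2003, Thm. 10.31] -/
theorem hodgeConjectureFor_tensor_iff_of_chowRankLEOneUpTo (hZ : IsSmoothProjective m Z) (hX : IsSmoothProjective n X) {k₀ : ℕ} (hCH : ChowRankLEOneUpTo X k₀) (hn : n ≤ 2 * k₀ + 2) :
    HodgeConjectureFor (m + n) (Z ⊗ X) ↔ HodgeConjectureFor m Z :=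
  hodgeConjectureFor_tensor_iff_of_forall_algebraic hZ hX (fun _ hj ↦ subsingleton_complexBetti_of_chowRankLEOneUpTo_of_odd hX hCH hn hj)
    (forall_algebraicClasses_eq_top_of_chowRankLEOneUpTo hX hCH hn)

/-- **`HC(Z) ⟹ HC(Z × X)`** under the same hypotheses on `X`. [cite: GrothendieckTopology1969, pp. 300–301] [cite: VoisinHodgeI2002, §11.3.3 Thm. 11.38, Thm. 11.40 and p. 287] [cite: VoisinHodgeII2003, Thm. 10.31] -/
theorem hodgeConjectureFor_tensor_of_chowRankLEOneUpTo_of_hodgeConjectureFor (hZ : IsSmoothProjective m Z) (hX : IsSmoothProjective n X) {k₀ : ℕ} (hCH : ChowRankLEOneUpTo X k₀)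
    (hn : n ≤ 2 * k₀ + 2) (hHC : HodgeConjectureFor m Z) : HodgeConjectureFor (m + n) (Z ⊗ X) :=
  (hodgeConjectureFor_tensor_iff_of_chowRankLEOneUpTo hZ hX hCH hn).2 hHC

/-- Mirror: **`HC(Z) ⟹ HC(X × Z)`** (the tree's `hodgeConjectureFor_tensor_comm_mp`). [cite: GrothendieckTopology1969, pp. 300–301] [cite: Arapura2006, §4 Lemma 4.2] [cite: VoisinHodgeII2003, Thm. 10.31] -/
theorem hodgeConjectureFor_tensor_of_chowRankLEOneUpTo_of_hodgeConjectureFor_left (hX : IsSmoothProjective n X) (hZ : IsSmoothProjective m Z) {k₀ : ℕ} (hCH : ChowRankLEOneUpTo X k₀)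
    (hn : n ≤ 2 * k₀ + 2) (hHC : HodgeConjectureFor m Z) : HodgeConjectureFor (n + m) (X ⊗ Z) :=
  hodgeConjectureFor_tensor_comm_mp hZ hX (hodgeConjectureFor_tensor_of_chowRankLEOneUpTo_of_hodgeConjectureFor hZ hX hCH hn hHC)

/-- **`GHC(Z)` in every bidegree ⟹ `GHC(Z × X)` in every bidegree**, when `CH₀(X), …, CH_{k₀}(X)` have rank `≤ 1` and `dim X ≤ 2k₀ + 2`. [cite: GrothendieckTopology1969, pp. 300–301] [cite: VoisinHodgeI2002, §11.3.3 Thm. 11.38]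
[cite: VoisinHodgeII2003, Thm. 10.31] -/
theorem forall_generalHodgePropertyFor_tensor_of_chowRankLEOneUpTo (hZ : IsSmoothProjective m Z) (hX : IsSmoothProjective n X) {k₀ : ℕ} (hCH : ChowRankLEOneUpTo X k₀) (hn : n ≤ 2 * k₀ + 2)
    (h : ∀ i r : ℕ, GeneralHodgePropertyFor m Z i r) (i r : ℕ) : GeneralHodgePropertyFor (m + n) (Z ⊗ X) i r :=
  forall_generalHodgePropertyFor_tensor_of_forall_algebraic hZ hX (fun _ hj ↦ subsingleton_complexBetti_of_chowRankLEOneUpTo_of_odd hX hCH hn hj)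
    (forall_algebraicClasses_eq_top_of_chowRankLEOneUpTo hX hCH hn) h i r

/-- **`GHC` in every bidegree for the product of two varieties with `CH₀, …, CH_{k}` of rank `≤ 1` and dimension `≤ 2k + 2`** (both have algebraic cohomology). [cite: GrothendieckTopology1969, pp. 300–301]
[cite: VoisinHodgeI2002, §11.3.3 Thm. 11.38] [cite: VoisinHodgeII2003, Thm. 10.31] -/
theorem forall_generalHodgePropertyFor_tensor_of_chowRankLEOneUpTo_both (hZ : IsSmoothProjective m Z) (hX : IsSmoothProjective n X) {k₁ k₀ : ℕ} (hCHZ : ChowRankLEOneUpTo Z k₁)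
    (hCH : ChowRankLEOneUpTo X k₀) (hm : m ≤ 2 * k₁ + 2) (hn : n ≤ 2 * k₀ + 2) (i r : ℕ) : GeneralHodgePropertyFor (m + n) (Z ⊗ X) i r :=
  generalHodgePropertyFor_tensor_of_forall_algebraic_both hZ hX (fun _ hj ↦ subsingleton_complexBetti_of_chowRankLEOneUpTo_of_odd hZ hCHZ hm hj)
    (fun _ hj ↦ subsingleton_complexBetti_of_chowRankLEOneUpTo_of_odd hX hCH hn hj) (forall_algebraicClasses_eq_top_of_chowRankLEOneUpTo hZ hCHZ hm)
    (forall_algebraicClasses_eq_top_of_chowRankLEOneUpTo hX hCH hn) i r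

/-! ### §4 Instances: surfaces with `CH₀ = ℤ`, fourfolds with `CH₀ = CH₁ = ℚ`, sixfolds with `CH₀ = CH₁ = CH₂ = ℚ` -/

/-- **`HC(Z × S) ⟺ HC(Z)` for every smooth projective `Z` and every smooth projective SURFACE `S` with `CH₀(S)_ℚ` of rank `≤ 1`** (`p_g = q = 0`, `H²(S)` algebraic — Bloch–Srinivas).
[cite: BlochSrinivas1983, Thm. 1] [cite: VoisinHodgeII2003, §10.2.2 Thm. 10.17 and Cor. 10.18] [cite: GrothendieckTopology1969, pp. 300–301] [cite: Arapura2006, §4 Lemma 4.2] -/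
theorem hodgeConjectureFor_tensor_surface_iff_of_chowRankLEOneUpTo_zero {S : SchemeOver ℂ} (hZ : IsSmoothProjective m Z) (hS : IsSmoothProjective 2 S) (hCH : ChowRankLEOneUpTo S 0) :
    HodgeConjectureFor (m + 2) (Z ⊗ S) ↔ HodgeConjectureFor m Z :=
  hodgeConjectureFor_tensor_iff_of_chowRankLEOneUpTo hZ hS hCH (by norm_num)

/-- **`HC(Z × F) ⟺ HC(Z)` for every smooth projective `Z` and every smooth projective FOURFOLD `F` with `CH₀(F)_ℚ, CH₁(F)_ℚ` of rank `≤ 1`** (all of `H*(F)` is algebraic). [cite: VoisinHodgeII2003, Thm. 10.29 and Thm. 10.31]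
[cite: GrothendieckTopology1969, pp. 300–301] [cite: Arapura2006, §4 Lemma 4.2] -/
theorem hodgeConjectureFor_tensor_fourfold_iff_of_chowRankLEOneUpTo_one {F : SchemeOver ℂ} (hZ : IsSmoothProjective m Z) (hF : IsSmoothProjective 4 F) (hCH : ChowRankLEOneUpTo F 1) :
    HodgeConjectureFor (m + 4) (Z ⊗ F) ↔ HodgeConjectureFor m Z :=
  hodgeConjectureFor_tensor_iff_of_chowRankLEOneUpTo hZ hF hCH (by norm_num)

/-- **`HC(Z × Y) ⟺ HC(Z)` for every smooth projective `Z` and every smooth projective SIXFOLD `Y` with `CH₀, CH₁, CH₂` of rank `≤ 1`.** [cite: VoisinHodgeII2003, Thm. 10.29 and Thm. 10.31] [cite: GrothendieckTopology1969, pp. 300–301]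
[cite: Arapura2006, §4 Lemma 4.2] -/
theorem hodgeConjectureFor_tensor_sixfold_iff_of_chowRankLEOneUpTo_two {Y : SchemeOver ℂ} (hZ : IsSmoothProjective m Z) (hY : IsSmoothProjective 6 Y) (hCH : ChowRankLEOneUpTo Y 2) :
    HodgeConjectureFor (m + 6) (Z ⊗ Y) ↔ HodgeConjectureFor m Z :=
  hodgeConjectureFor_tensor_iff_of_chowRankLEOneUpTo hZ hY hCH (by norm_num)

end Literature.AlgebraicGeometry.HodgeTheory

end
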